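import Mathlib.Algebra.BigOperators.GroupWithZero.Finset
import Mathlib.Algebra.BigOperators.Group.Finset.Piecewise
import Mathlib.Algebra.BigOperators.Group.Finset.Sigma
import Mathlib.Tactic.LinearCombination
import Mathlib.Tactic.Ring
import Mathlib.Tactic.NormNum
import Summits.PneNP.PneNP.Theorems.OneSliceSliceACZeroDefs

/-!
# Route OneSlice, crux `SliceACZero` (stmt-PneNP-2835), line `russo-window-ladder`: the AND-coin identity

Stub `stub_andCoin` of the skeleton `Summits/PneNP/PneNP/Cruxes/SliceACZero/Lines/russo-window-ladder.lean`.
For every Boolean `f` on a finite cube `{0,1}^ι` (`N = |ι|`) and every real `q` (the stub states it for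
`0 ≤ q ≤ 1/2`, where all weights are probabilities; the identity is polynomial in `q`):

  `2q · I_q(f) = Σ_y μ_{2q}(y) · I_{1/2}(f_y)`,  `f_y(z) = f(y ∧ z)`,

where `I_q(f) = biasedInfluence q f = Σ_{(x,i) ∈ upPivotal f} q^{|x|}(1−q)^{N−1−|x|}` is the unsigned
`μ_q`-total influence and `μ_{2q}(y) = prodWeight (2q) y = (2q)^{|y|}(1−2q)^{N−|y|}`. In words: sampling
`x = y ∧ z` with `y ∼ μ_{2q}`, `z ∼ μ_{1/2}` realises `x ∼ μ_q`, and `(z, i)` is an up-pivotal edge of `f_y`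
iff `y_i = 1` and `(y ∧ z, i)` is an up-pivotal edge of `f` (the `∧`-gadget of Rossman 2008 applied to the
influence functional; O'Donnell 2014, §8.4, for `μ_q`-influences).

Proof (double counting with finite sums of reals; no probability theory):
* `mem_upPivotal_and` — the pivotality transfer just described; on an up-pivotal edge `(z, i)` the unbiased
  weight `(1/2)^{|z|}(1/2)^{N−1−|z|}` is the constant `(1/2)^{N−1}` (`|z| ≤ N − 1`);
* `sum_fiber_and` — regroup the sum over the pairs `(y, z)` along the fibres of `(y, z) ↦ y ∧ z`;
* `sum_fiber_weight` — for `x` with `x_j = 0`: `Σ_{y ∧ z = x, y_j = 1} μ_a(y) = a^{|x|+1} (2 − a)^{N−1−|x|}`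
  (the summand is a product over coordinates; exchange `Σ Π = Π Σ`, `Fintype.prod_sum`: the coordinate `j`
  and the support of `x` contribute a factor `a`, every other coordinate `a + 2(1 − a) = 2 − a`);
* `half_pow_mul` — `(1/2)^{N−1} (2q)^{|x|+1} (2−2q)^{N−1−|x|} = 2q · q^{|x|}(1−q)^{N−1−|x|}`; summing over
  `upPivotal f` direction by direction (`sum_direction`) gives the identity.

Vocabulary (`wt`, `prodWeight`, `upPivotal`, `biasedInfluence`, `prodWeight_eq_prod`,
`wt_lt_card_of_mem_upPivotal`) from `Summits.PneNP.PneNP.Theorems.OneSliceSliceACZeroDefs`. [folklore]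
-/

noncomputable section

namespace Summit.PneNP.PneNP.Cruxes.SliceACZero.RussoWindowLadder

open scoped BigOperators
open Finset

set_option linter.dupNamespace false -- D-0017: `Summit.PneNP.PneNP.…` repeats `PneNP` by design

namespace AndCoin

variable {ι : Type} [Fintype ι] [DecidableEq ι]

/-- **Pivotality transfer under `∧`-restriction.** `(z, j)` is an up-pivotal edge of `f_y : z ↦ f (y ∧ z)`
iff `y_j = 1` and `(y ∧ z, j)` is an up-pivotal edge of `f`. [folklore] -/
theorem mem_upPivotal_and (f : (ι → Bool) → Bool) (y z : ι → Bool) (j : ι) :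
    ((z, j) ∈ upPivotal fun v => f (fun k => y k && v k)) ↔
      (y j = true ∧ ((fun k => y k && z k), j) ∈ upPivotal f) := by
  simp only [upPivotal, Finset.mem_filter, Finset.mem_univ, true_and]
  cases hy : y j
  · -- `y_j = 0`: setting `z_j := 1` does not change `y ∧ z`
    have h : (fun k => y k && Function.update z j true k) = fun k => y k && z k := by
      funext k
      by_cases hk : k = j
      · subst hk; simp [hy]
      · rw [Function.update_of_ne hk]
    rw [h]
    simp
  · -- `y_j = 1`: setting `z_j := 1` is setting `(y ∧ z)_j := 1`
    have h : (fun k => y k && Function.update z j true k) =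
        Function.update (fun k => y k && z k) j true := by
      funext k
      by_cases hk : k = j
      · subst hk; simp [hy]
      · rw [Function.update_of_ne hk, Function.update_of_ne hk]
    rw [h]
    simp

/-- Regrouping a double sum over `(y, z)` along the fibres of `(y, z) ↦ y ∧ z`. [folklore] -/
theorem sum_fiber_and (F : (ι → Bool) → (ι → Bool) → ℝ) (G : (ι → Bool) → ℝ) :
    ∑ y : ι → Bool, ∑ z : ι → Bool, F y z * G (fun k => y k && z k) =
      ∑ x : ι → Bool, G x * ∑ y : ι → Bool, ∑ z : ι → Bool,
        (if (fun k => y k && z k) = x then F y z else 0) := by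
  have key : ∀ y z : ι → Bool, F y z * G (fun k => y k && z k) =
      ∑ x : ι → Bool, if (fun k => y k && z k) = x then G x * F y z else 0 := by
    intro y z
    rw [Fintype.sum_ite_eq]
    exact mul_comm _ _
  simp_rw [key]
  rw [Finset.sum_comm_cycle]
  refine Finset.sum_congr rfl fun x _ => ?_
  rw [Finset.mul_sum]
  refine Finset.sum_congr rfl fun y _ => ?_
  rw [Finset.mul_sum]
  refine Finset.sum_congr rfl fun z _ => ?_
  rw [mul_ite, mul_zero]

/-- **The fibre weight.** For `x` with `x_j = 0`: summing `μ_a(y)` (times a constant `c`) over the pairs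
`(y, z)` with `y ∧ z = x` and `y_j = 1` gives `c · a^{|x|+1} (2 − a)^{N−1−|x|}`: coordinatewise, `j` and the
support of `x` contribute a factor `a` (`y_k = 1`, `z_k = x_k`), every other coordinate `a + 2(1 − a)`
(`y_k = 1, z_k = 0`, or `y_k = 0` and `z_k` free). [folklore] -/
theorem sum_fiber_weight (x : ι → Bool) (j : ι) (hx : x j = false) (a c : ℝ) :
    ∑ y : ι → Bool, ∑ z : ι → Bool,
        (if (fun k => y k && z k) = x then prodWeight a y * (if y j = true then c else 0) else 0) =
      c * (a ^ (wt x + 1) * (2 - a) ^ (Fintype.card ι - (wt x + 1))) := by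
  -- the coordinatewise factors of the summand
  obtain ⟨F, hF⟩ : ∃ F : ι → Bool → Bool → ℝ, ∀ k b d, F k b d =
      (if b = true then a else if k = j then 0 else 1 - a) * (if (b && d) = x k then 1 else 0) :=
    ⟨_, fun _ _ _ => rfl⟩
  -- (1) the summand is `c · Π_k F_k(y_k, z_k)`
  have hprod : ∀ y z : ι → Bool,
      (if (fun k => y k && z k) = x then prodWeight a y * (if y j = true then c else 0) else 0) =
        c * ∏ k, F k (y k) (z k) := by
    intro y z
    have h1 : ∏ k, F k (y k) (z k) = (∏ k, (if y k = true then a else if k = j then 0 else 1 - a)) *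
        ∏ k, (if (y k && z k) = x k then (1 : ℝ) else 0) := by
      rw [← Finset.prod_mul_distrib]
      exact Finset.prod_congr rfl fun k _ => hF k (y k) (z k)
    have h2 : ∏ k, (if y k = true then a else if k = j then 0 else 1 - a) =
        if y j = true then prodWeight a y else 0 := by
      cases hy : y j
      · rw [if_neg Bool.false_ne_true]
        exact Finset.prod_eq_zero (Finset.mem_univ j) (by simp [hy])
      · rw [if_pos rfl, prodWeight_eq_prod]
        refine Finset.prod_congr rfl fun k _ => ?_
        by_cases hk : k = j
        · subst hk; simp [hy]
        · rw [if_neg hk]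
    rw [h1, h2, Fintype.prod_boole]
    by_cases hyz : (fun k => y k && z k) = x
    · rw [if_pos hyz, if_pos (show ∀ k, (y k && z k) = x k from fun k => congrFun hyz k)]
      split_ifs <;> ring
    · rw [if_neg hyz, if_neg (show ¬ ∀ k, (y k && z k) = x k from fun h => hyz (funext h))]
      split_ifs <;> ring
  -- (2) the coordinate sums
  have hcoord : ∀ k, ∑ b : Bool, ∑ d : Bool, F k b d = if k = j ∨ x k = true then a else 2 - a := by
    intro k
    simp only [Fintype.sum_bool, hF]
    by_cases hk : k = j
    · subst hk
      simp [hx]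
    · cases x k
      · simp [hk]
        ring
      · simp [hk]
  -- (3) the number of coordinates contributing a factor `a`
  have hcard : #(univ.filter fun k => k = j ∨ x k = true) = wt x + 1 := by
    have h : (univ.filter fun k => k = j ∨ x k = true) = insert j (univ.filter fun k => x k = true) := by
      ext k; simp
    rw [h, Finset.card_insert_of_notMem]
    · rfl
    · simp [hx]
  have hcard' : #(univ.filter fun k => ¬(k = j ∨ x k = true)) = Fintype.card ι - (wt x + 1) := by
    have h := Finset.card_filter_add_card_filter_not (s := (univ : Finset ι)) (fun k => k = j ∨ x k = true)
    rw [Finset.card_univ, hcard] at h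
    omega
  -- assemble: `Σ_y Σ_z Π_k = Π_k Σ_b Σ_d`
  calc ∑ y : ι → Bool, ∑ z : ι → Bool,
        (if (fun k => y k && z k) = x then prodWeight a y * (if y j = true then c else 0) else 0)
      = ∑ y : ι → Bool, ∑ z : ι → Bool, c * ∏ k, F k (y k) (z k) :=
        Finset.sum_congr rfl fun y _ => Finset.sum_congr rfl fun z _ => hprod y z
    _ = c * ∑ y : ι → Bool, ∏ k, ∑ d : Bool, F k (y k) d := by
        rw [Finset.mul_sum]
        refine Finset.sum_congr rfl fun y _ => ?_
        rw [← Finset.mul_sum]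
        congr 1
        exact (Fintype.prod_sum fun k d => F k (y k) d).symm
    _ = c * ∏ k, ∑ b : Bool, ∑ d : Bool, F k b d := by
        congr 1
        exact (Fintype.prod_sum fun k b => ∑ d : Bool, F k b d).symm
    _ = c * ∏ k, (if k = j ∨ x k = true then a else 2 - a) := by
        congr 1
        exact Finset.prod_congr rfl fun k _ => hcoord k
    _ = c * (a ^ (wt x + 1) * (2 - a) ^ (Fintype.card ι - (wt x + 1))) := by
        rw [Finset.prod_ite, Finset.prod_const, Finset.prod_const, hcard, hcard']

/-- `(1/2)^{N−1} (2q)^{m+1} (2−2q)^{N−1−m} = 2q · q^m (1−q)^{N−1−m}` for `m < N`. [folklore] -/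
theorem half_pow_mul (q : ℝ) {m N : ℕ} (h : m < N) :
    (1 / 2 : ℝ) ^ (N - 1) * ((2 * q) ^ (m + 1) * (2 - 2 * q) ^ (N - (m + 1))) =
      2 * q * (q ^ m * (1 - q) ^ (N - 1 - m)) := by
  obtain ⟨n, rfl⟩ : ∃ n, N = m + 1 + n := ⟨N - (m + 1), by omega⟩
  rw [show m + 1 + n - 1 - m = n by omega, show m + 1 + n - 1 = m + n by omega,
    show m + 1 + n - (m + 1) = n by omega, show (2 : ℝ) - 2 * q = 2 * (1 - q) by ring, mul_pow, mul_pow]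
  have h2 : (1 / 2 : ℝ) ^ (m + n) * 2 ^ (m + n) = 1 := by rw [← mul_pow]; norm_num
  linear_combination (2 * q * (q ^ m * (1 - q) ^ n)) * h2

/-- The influence as a double sum over directions and points, with the pivotality indicator. [folklore] -/
theorem biasedInfluence_eq_sum (r : ℝ) (g : (ι → Bool) → Bool) :
    biasedInfluence r g = ∑ j : ι, ∑ x : ι → Bool,
      (if (x, j) ∈ upPivotal g then r ^ wt x * (1 - r) ^ (Fintype.card ι - 1 - wt x) else 0) := by
  rw [biasedInfluence, ← Finset.sum_ite_mem_eq (upPivotal g), Fintype.sum_prod_type_right]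

/-- **The identity in direction `j`.**
`Σ_x [(x,j) ∈ upPivotal f] · 2q · q^{|x|}(1−q)^{N−1−|x|}
  = Σ_y Σ_z μ_{2q}(y) · [(z,j) ∈ upPivotal f_y] · (1/2)^{|z|} (1/2)^{N−1−|z|}`. [folklore] -/
theorem sum_direction (f : (ι → Bool) → Bool) (q : ℝ) (j : ι) :
    ∑ x : ι → Bool, 2 * q * (if (x, j) ∈ upPivotal f then
        q ^ wt x * (1 - q) ^ (Fintype.card ι - 1 - wt x) else 0) =
      ∑ y : ι → Bool, ∑ z : ι → Bool, prodWeight (2 * q) y *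
        (if (z, j) ∈ upPivotal (fun v => f (fun k => y k && v k)) then
          (1 / 2 : ℝ) ^ wt z * (1 - 1 / 2) ^ (Fintype.card ι - 1 - wt z) else 0) := by
  -- Step 1: pivotality transfer; the unbiased weight on an up-pivotal edge is `(1/2)^{N-1}`
  have h1 : ∀ y z : ι → Bool, prodWeight (2 * q) y *
      (if (z, j) ∈ upPivotal (fun v => f (fun k => y k && v k)) then
          (1 / 2 : ℝ) ^ wt z * (1 - 1 / 2) ^ (Fintype.card ι - 1 - wt z) else 0) =
        (prodWeight (2 * q) y * (if y j = true then (1 / 2 : ℝ) ^ (Fintype.card ι - 1) else 0)) *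
          (if ((fun k => y k && z k), j) ∈ upPivotal f then (1 : ℝ) else 0) := by
    intro y z
    by_cases h : (z, j) ∈ upPivotal (fun v => f (fun k => y k && v k))
    · obtain ⟨hy, hm⟩ := (mem_upPivotal_and f y z j).1 h
      have hw : wt z < Fintype.card ι := wt_lt_card_of_mem_upPivotal h
      rw [if_pos h, if_pos hy, if_pos hm, mul_one, show (1 : ℝ) - 1 / 2 = 1 / 2 by norm_num, ← pow_add,
        show wt z + (Fintype.card ι - 1 - wt z) = Fintype.card ι - 1 by omega]
    · rw [if_neg h, mul_zero]
      by_cases hm : ((fun k => y k && z k), j) ∈ upPivotal f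
      · have hy : ¬ y j = true := fun hy => h ((mem_upPivotal_and f y z j).2 ⟨hy, hm⟩)
        rw [if_neg hy, mul_zero, zero_mul]
      · rw [if_neg hm, mul_zero]
  have h1' : (∑ y : ι → Bool, ∑ z : ι → Bool, prodWeight (2 * q) y *
      (if (z, j) ∈ upPivotal (fun v => f (fun k => y k && v k)) then
          (1 / 2 : ℝ) ^ wt z * (1 - 1 / 2) ^ (Fintype.card ι - 1 - wt z) else 0)) =
        ∑ y : ι → Bool, ∑ z : ι → Bool,
          (prodWeight (2 * q) y * (if y j = true then (1 / 2 : ℝ) ^ (Fintype.card ι - 1) else 0)) *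
            (if ((fun k => y k && z k), j) ∈ upPivotal f then (1 : ℝ) else 0) :=
    Finset.sum_congr rfl fun y _ => Finset.sum_congr rfl fun z _ => h1 y z
  -- Step 2: regroup along `x = y ∧ z` and evaluate each fibre
  rw [h1', sum_fiber_and (fun y _ => prodWeight (2 * q) y *
      (if y j = true then (1 / 2 : ℝ) ^ (Fintype.card ι - 1) else 0))
    (fun x => if (x, j) ∈ upPivotal f then (1 : ℝ) else 0)]
  refine Finset.sum_congr rfl fun x _ => ?_
  by_cases hx : (x, j) ∈ upPivotal f
  · have hxj : x j = false := (Finset.mem_filter.1 hx).2.1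
    have hw : wt x < Fintype.card ι := wt_lt_card_of_mem_upPivotal hx
    rw [if_pos hx, if_pos hx, one_mul, sum_fiber_weight x j hxj (2 * q) ((1 / 2 : ℝ) ^ (Fintype.card ι - 1))]
    exact (half_pow_mul q hw).symm
  · rw [if_neg hx, if_neg hx, zero_mul, mul_zero]

end AndCoin

open AndCoin in
/-- **AND-coin identity** (stub `stub_andCoin` of the line `russo-window-ladder`). For every Boolean `f` on
`{0,1}^ι` and `0 ≤ q ≤ 1/2`: `2q · I_q(f) = Σ_y μ_{2q}(y) · I_{1/2}(f_y)`, `f_y(z) = f(y ∧ z)`, where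
`I_q = biasedInfluence q` is the unsigned `μ_q`-total influence and `μ_{2q} = prodWeight (2q)`. (A polynomial
identity in `q`; the hypotheses on `q` are not used.) Proof: expand both influences direction by direction
(`biasedInfluence_eq_sum`) and apply `sum_direction`: pivotality transfer `mem_upPivotal_and`, regrouping
along `x = y ∧ z` (`sum_fiber_and`), the fibre weight `sum_fiber_weight` (binomial theorem over the free
coordinates) and the arithmetic `half_pow_mul`. [folklore] -/
theorem stub_andCoin :
    ∀ (ι : Type) [Fintype ι] [DecidableEq ι] (f : (ι → Bool) → Bool) (q : ℝ), 0 ≤ q → 2 * q ≤ 1 →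
      2 * q * biasedInfluence q f =
        ∑ y : ι → Bool, prodWeight (2 * q) y *
          biasedInfluence (1 / 2) (fun z => f (fun i => y i && z i)) := by
  intro ι _ _ f q _ _
  simp_rw [biasedInfluence_eq_sum, Finset.mul_sum]
  conv_rhs => rw [Finset.sum_comm]
  exact Finset.sum_congr rfl fun j _ => sum_direction f q j

end Summit.PneNP.PneNP.Cruxes.SliceACZero.RussoWindowLadder

end
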